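import Mathlib

/-!
# DiscreteObjects / Verify — kernel-checked Latin-square / MOLS / projective-plane verifier (cell pub-namedobj, seat verify-ref)

Framing: lottery ticket; floor = certified bounds/negative ranges.

Third (kernel) check for target (M): `isLatin`, `orthogonal`, `isMOLS` and `isProjectivePlane` are
Bool-valued computations on explicit lists; `decide` makes the kernel evaluate them on the controls
(2 MOLS(3), 3 MOLS(4) from GF(4), the Fano plane). A hit (3 MOLS(10), plane of order 12) would be
certified by the same functions on the explicit object (`native_decide` / farm for size).
-/

namespace Summit.Ventures.DiscreteObjects.Verify

/-- `r` is a permutation of `0..n-1` (as a list of length n) -/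
def isPerm (n : Nat) (r : List Nat) : Bool :=
  r.length = n && (List.range n).all (fun s => r.contains s)

/-- the j-th column of a square given as a list of rows -/
def column (L : List (List Nat)) (j : Nat) : List Nat := L.map (fun r => r.getD j 0)

/-- Latin square of order n on symbols 0..n-1 -/
def isLatin (L : List (List Nat)) : Bool :=
  let n := L.length
  L.all (isPerm n) && (List.range n).all (fun j => isPerm n (column L j))

/-- orthogonality: all n² ordered pairs (A i j, B i j) distinct -/
def orthogonal (A B : List (List Nat)) : Bool :=
  let n := A.length
  let pairs := (List.range n).flatMap (fun i => (List.range n).map (fun j =>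
    ((A.getD i []).getD j 0, (B.getD i []).getD j 0)))
  pairs.Nodup

/-- a list of squares is a set of MOLS: all Latin and pairwise orthogonal -/
def isMOLS (Ls : List (List (List Nat))) : Bool :=
  Ls.all isLatin && (List.range Ls.length).all (fun a => (List.range Ls.length).all (fun b =>
    a ≥ b || orthogonal (Ls.getD a []) (Ls.getD b [])))

/-- projective plane of order n: n²+n+1 lines of n+1 points each (points 0..n²+n), every pair of
points on exactly one line, every pair of lines meeting in exactly one point -/
def isProjectivePlane (n : Nat) (lines : List (List Nat)) : Bool :=
  let v := n * n + n + 1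
  lines.length = v && lines.all (fun l => l.length = n + 1 && l.Nodup && l.all (· < v)) &&
  (List.range v).all (fun p => (List.range v).all (fun q =>
    p ≥ q || (lines.filter (fun l => l.contains p && l.contains q)).length = 1)) &&
  (List.range v).all (fun a => (List.range v).all (fun b =>
    a ≥ b || ((lines.getD a []).filter (fun p => (lines.getD b []).contains p)).length = 1))

/-- GF(4) as 0..3 (a + 2b ↔ a + bω, ω² = ω + 1) -/
def gf4mul (x y : Nat) : Nat :=
  let a0 := x % 2; let a1 := x / 2; let b0 := y % 2; let b1 := y / 2
  let c0 := (a0 * b0 + a1 * b1) % 2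
  let c1 := (a0 * b1 + a1 * b0 + a1 * b1) % 2
  c0 + 2 * c1
/-- addition in GF(4) coded as 0..3 -/
def gf4add (x y : Nat) : Nat := (x % 2 + y % 2) % 2 + 2 * ((x / 2 + y / 2) % 2)

/-- the three MOLS(4) `L_a(i,j) = a·i + j` over GF(4), a = 1,2,3 -/
def mols4 : List (List (List Nat)) :=
  [1, 2, 3].map (fun a => (List.range 4).map (fun i => (List.range 4).map (fun j => gf4add (gf4mul a i) j)))

/-- the two MOLS(3) `L_a(i,j) = a·i + j` over GF(3), a = 1,2 -/
def mols3 : List (List (List Nat)) :=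
  [1, 2].map (fun a => (List.range 3).map (fun i => (List.range 3).map (fun j => (a * i + j) % 3)))

/-- the Fano plane PG(2,2) as 7 lines on points 0..6 -/
def fano : List (List Nat) := [[0,1,2],[0,3,4],[0,5,6],[1,3,5],[1,4,6],[2,3,6],[2,4,5]]

/-- control M+2′: 2 MOLS(3) -/
theorem mols3_ok : isMOLS mols3 = true := by decide
/-- control M+2′: 3 MOLS(4) -/
theorem mols4_ok : isMOLS mols4 = true := by decide
/-- control M+1′: Fano plane -/
theorem fano_ok : isProjectivePlane 2 fano = true := by decide
/-- control M−4′: Fano with one incidence removed is rejected -/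
theorem fano_broken : isProjectivePlane 2 (fano.set 0 [0,1]) = false := by decide
/-- control M−3′: a square paired with itself is not orthogonal -/
theorem self_not_orthogonal : orthogonal (mols3.getD 0 []) (mols3.getD 0 []) = false := by decide

end Summit.Ventures.DiscreteObjects.Verify
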